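import Summits.CriticalPhenomena.PercolationContinuityZ3.Theorems.PercNearOneGluingNoHeavyLowerTailQ44bCrossPendantExchange
import HarnessLib

/-!
# The pair transplant `P(ab|cy) · P(a|by|c) ≤ P(ab|c|y) · P(a|bcy)` (all `n`, all weights)

Support file for crux `stmt-CriticalPhenomena-4575` (master-family programme, the `Q44b` / `ND_a` line), seat
`prim-l12-p6` gen 7; memo `run/shared/lean/prim/prim-l12/FROM-prim-l12-p6-g7-Q44B-PENCIL-CONCAVITY.md` §3c.

Bond percolation `μ = prodBernoulli w` on a finite vertex type, four vertices `a b c y`, `P(π)` the probability of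
the partition `π` of `{a,b,c,y}` induced by the open clusters.  This file proves, for every finite weighted graph,

  `pairTransplant`:  `P(ab|cy) · P(a|by|c) ≤ P(ab|c|y) · P(a|bcy)`

("move the attachment of `c` to `y` from the copy in which `a ~ b` to the copy in which `a` is isolated and
`b ~ y`").  With the conditional Ahlswede–Daykin row `P(ab|c|y)·[P(a|by|c)+P(ay|b|c)] ≤ P(a|b|c|y)·P(aby|c)` (an
instance of the tree's `condAG_isolatedSet_lab`, isolated set `{c}`) it gives the concavity of the row `Q44b`
along the one-bond pencil of the edge `{a,c}` (the `z = c` case of `Q44b.NDa`, memo §3c), just as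
`crossPendant_exchange_sum` is the `z = b` case.

Proof: with `D = {a}↮{c,y}`, `A = {a~b}` (increasing in `C_a`), `E = {c~y}`, `B = {b~y}` (increasing in `C_{c,y}`,
resp. `C_{b,c,y}`): (N) BHK negative correlation on `D`: `μ(D∩A∩E)·μ(D) ≤ μ(D∩A)·μ(D∩E)`; (P) BHK positive
correlation on `D' = D ∖ A = {a}↮{b,c,y}` (`Q44bExchange.stepA`): `μ(D'∩B)·μ(D'∩E) ≤ μ(D'∩B∩E)·μ(D')`; and the
bookkeeping `P(ab|cy) = μ(D∩A∩E)`, `P(ab|c|y) = μ(D∩A) − μ(D∩A∩E)`, `P(a|bcy) = μ(D'∩B∩E)`,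
`P(a|by|c) = μ(D'∩B) − μ(D'∩B∩E)`.  Theorems only; standard axioms.
-/

namespace Summit.CriticalPhenomena.PercolationContinuityZ3.Theorems

namespace Q44bExchange

open MeasureTheory Set
open Literature.Probability.LatticeModels (prodBernoulli)
open Literature.Probability.Percolation

variable {V : Type*} [Fintype V]

/-- **(N)** given `{a} ↮ {c,y}`, the events `{a~b}` (a function of `C_a`) and `{c~y}` (a function of `C_{c,y}`) are
negatively correlated: `μ(D∩ab∩cy)·μ(D) ≤ μ(D∩ab)·μ(D∩cy)`, `D = {a≁c} ∩ {a≁y}`.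
[cite: VandenbergHaggstromKahn2005, Thm. 2.1 (p. 9) at q = 1 — corollary] -/
theorem pairTransplant_neg (w : Sym2 V → unitInterval) (a b c y : V) :
    (prodBernoulli w).real ((openConn a c)ᶜ ∩ (openConn a y)ᶜ ∩ (openConn a b ∩ openConn c y)) *
        (prodBernoulli w).real ((openConn a c)ᶜ ∩ (openConn a y)ᶜ) ≤
      (prodBernoulli w).real ((openConn a c)ᶜ ∩ (openConn a y)ᶜ ∩ openConn a b) *
        (prodBernoulli w).real ((openConn a c)ᶜ ∩ (openConn a y)ᶜ ∩ openConn c y) := by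
  classical
  have ha : a ∈ ({a} : Set V) := by simp
  have hc : c ∈ ({c, y} : Set V) := by simp
  have key := setClusterEventExchange w ({a} : Set V) ({c, y} : Set V)
    (fun C => (SimpleGraph.fromEdgeSet C).Reachable a b) (fun _ => True)
    (fun C => (SimpleGraph.fromEdgeSet C).Reachable c y) (fun _ => True)
    (PathExchange.reachIn_mono a b) (fun _ _ _ h => h)
    (PathExchange.reachIn_mono c y) (fun _ _ _ h => h)
  have hD : {ω : BondConfig V | ∀ s ∈ ({a} : Set V), ∀ t ∈ ({c, y} : Set V),
      ¬ (openGraph ω).Reachable s t} = (openConn a c)ᶜ ∩ (openConn a y)ᶜ := by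
    ext ω
    simp only [mem_setOf_eq, mem_insert_iff, mem_singleton_iff, forall_eq_or_imp, forall_eq,
      mem_inter_iff, mem_compl_iff, openConn]
  simp only [setOf_fromEdgeSet_biUnion_reachable _ ha, setOf_fromEdgeSet_biUnion_reachable _ hc,
    setOf_true, inter_univ, hD] at key
  exact key

/-- **Pair transplant (all `n`, all weights).**  For `μ = prodBernoulli w` and vertices `a b c y`:
`P(ab|cy) · P(a|by|c) ≤ P(ab|c|y) · P(a|bcy)`, the cells written as `ab|cy = {a≁c,a≁y, a~b, c~y}`,
`a|by|c = {a≁b,a≁c,a≁y, b~y, c≁y}`, `ab|c|y = {a≁c,a≁y, a~b, c≁y}`, `a|bcy = {a≁b,a≁c,a≁y, b~y, c~y}` (the omitted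
literals are implied). [this work] -/
theorem pairTransplant (w : Sym2 V → unitInterval) (a b c y : V) :
    (prodBernoulli w).real ((openConn a c)ᶜ ∩ (openConn a y)ᶜ ∩ (openConn a b ∩ openConn c y)) *
        (prodBernoulli w).real ((openConn a b)ᶜ ∩ (openConn a c)ᶜ ∩ (openConn a y)ᶜ ∩ openConn b y ∩
          (openConn c y)ᶜ) ≤
      (prodBernoulli w).real ((openConn a c)ᶜ ∩ (openConn a y)ᶜ ∩ openConn a b ∩ (openConn c y)ᶜ) *
        (prodBernoulli w).real ((openConn a b)ᶜ ∩ (openConn a c)ᶜ ∩ (openConn a y)ᶜ ∩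
          (openConn b y ∩ openConn c y)) := by
  classical
  set μ := prodBernoulli w with hμ
  set D : Set (BondConfig V) := (openConn a c)ᶜ ∩ (openConn a y)ᶜ with hD
  set D0 : Set (BondConfig V) := (openConn a b)ᶜ ∩ (openConn a c)ᶜ ∩ (openConn a y)ᶜ with hD0
  set Ab : Set (BondConfig V) := openConn a b with hAb
  set E : Set (BondConfig V) := openConn c y with hE
  set By : Set (BondConfig V) := openConn b y with hBy
  have hN := pairTransplant_neg w a b c y
  have hP := stepA w a b c y
  simp only [← hμ, ← hD, ← hD0, ← hAb, ← hE, ← hBy] at hN hP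
  set δ := μ.real D
  set pAE := μ.real (D ∩ (Ab ∩ E))
  set pA := μ.real (D ∩ Ab)
  set pE := μ.real (D ∩ E)
  set δ0 := μ.real D0
  set mB := μ.real (D0 ∩ By)
  set mE := μ.real (D0 ∩ E)
  set mBE := μ.real (D0 ∩ (By ∩ E))
  have hmeas : ∀ s : Set (BondConfig V), MeasurableSet s := fun _ => MeasurableSet.of_discrete
  -- bookkeeping
  have hDD0 : D \ Ab = D0 := by
    ext ω; simp only [hD, hD0, mem_sdiff, mem_inter_iff, mem_compl_iff]; tauto
  have e1 : δ = pA + δ0 := by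
    have h := measureReal_inter_add_sdiff (μ := μ) (s := D) (hmeas Ab)
    rw [hDD0] at h; linarith
  have e2 : pE = pAE + mE := by
    have h := measureReal_inter_add_sdiff (μ := μ) (s := D ∩ E) (hmeas Ab)
    have hs1 : D ∩ E ∩ Ab = D ∩ (Ab ∩ E) := by ext ω; simp only [mem_inter_iff]; tauto
    have hs2 : (D ∩ E) \ Ab = D0 ∩ E := by
      ext ω; simp only [hD, hD0, mem_sdiff, mem_inter_iff, mem_compl_iff]; tauto
    rw [hs1, hs2] at h; linarith
  have e3 : μ.real (D ∩ Ab ∩ Eᶜ) = pA - pAE := by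
    have h := measureReal_inter_add_sdiff (μ := μ) (s := D ∩ Ab) (hmeas E)
    have hs1 : D ∩ Ab ∩ E = D ∩ (Ab ∩ E) := by ext ω; simp only [mem_inter_iff]; tauto
    have hs2 : (D ∩ Ab) \ E = D ∩ Ab ∩ Eᶜ := by ext ω; simp only [mem_sdiff, mem_inter_iff, mem_compl_iff]
    rw [hs1, hs2] at h; linarith
  have e4 : μ.real (D0 ∩ By ∩ Eᶜ) = mB - mBE := by
    have h := measureReal_inter_add_sdiff (μ := μ) (s := D0 ∩ By) (hmeas E)
    have hs1 : D0 ∩ By ∩ E = D0 ∩ (By ∩ E) := by ext ω; simp only [mem_inter_iff]; tauto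
    have hs2 : (D0 ∩ By) \ E = D0 ∩ By ∩ Eᶜ := by ext ω; simp only [mem_sdiff, mem_inter_iff, mem_compl_iff]
    rw [hs1, hs2] at h; linarith
  rw [e3, e4]
  have hpAE : 0 ≤ pAE := measureReal_nonneg
  have hpA : 0 ≤ pA := measureReal_nonneg
  have hmB : 0 ≤ mB := measureReal_nonneg
  have hmBE : 0 ≤ mBE := measureReal_nonneg
  have hδ0 : 0 ≤ δ0 := measureReal_nonneg
  have hmBle : mB ≤ δ0 := measureReal_mono inter_subset_left
  have hpAEle : pAE ≤ pA := measureReal_mono (inter_subset_inter_right _ inter_subset_left)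
  -- (N): pAE δ ≤ pA pE ;  (P): mB mE ≤ mBE δ0.  Goal: pAE (mB − mBE) ≤ (pA − pAE) mBE, i.e. pAE mB ≤ pA mBE.
  rw [e1, e2] at hN
  have hmain : δ0 * (pAE * mB) ≤ δ0 * (pA * mBE) := by
    -- from (N): pAE δ0 ≤ pA mE ; then pAE δ0 mB ≤ pA mE mB ≤ pA mBE δ0
    have hN' : pAE * δ0 ≤ pA * mE := by nlinarith
    have h1 : mB * (pAE * δ0) ≤ mB * (pA * mE) := mul_le_mul_of_nonneg_left hN' hmB
    have h2 : pA * (mB * mE) ≤ pA * (mBE * δ0) := mul_le_mul_of_nonneg_left hP hpA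
    nlinarith
  rcases hδ0.eq_or_lt with h0 | hpos
  · have hmB0 : mB = 0 := le_antisymm (h0 ▸ hmBle) hmB
    have hmBE0 : mBE = 0 :=
      le_antisymm (hmB0 ▸ (measureReal_mono (inter_subset_inter_right _ inter_subset_left) : mBE ≤ mB))
        hmBE
    rw [hmB0, hmBE0]
    simp
  · have h := le_of_mul_le_mul_left hmain hpos
    nlinarith

end Q44bExchange

end Summit.CriticalPhenomena.PercolationContinuityZ3.Theorems
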